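import Summits.ValiantsHypothesis.ValiantsHypothesis.Statement
import Literature.Computability.AlgebraicComplexity.ValiantClasses
import Literature.Computability.AlgebraicComplexity.CircuitDepth
import Literature.Computability.AlgebraicComplexity.StandardFamilies
import Literature.Computability.AlgebraicComplexity.OrbitClosure
import Literature.Computability.AlgebraicComplexity.ArithCircuitProjections
import Literature.Computability.AlgebraicComplexity.ArithCircuitCodeBounds
import Literature.Computability.AlgebraicComplexity.BLMW11ApproximationProjections
import Literature.LinearAlgebra.Matrix.RankMinors
import HarnessLib

/-!
# Route `VPBoundarySquare` — border transfer for measure-based squares (the product-depth dial in border form)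

Decomp-valiant workshop, lens 3 «border-complexity / debordering axis», generation 11; authored by the lens seat.
Unconditional, 0 sorry, no named fact; it does NOT prove VP ≠ VNP and closes no item.  Cross-lens record addendum:
what the border axis says about a square whose attackable piece is a LOWER BOUND proved by equations.

THE BORDER DIAL.  For a depth function `Δ : ℕ → ℕ` write (lens 4, `Theses/DepthWindow.lean`,
`Theorems/DepthWindowDial.lean`, predicates written out there; here they get names)
`D(σ, Δ, s)` = polynomials in the variables `σ` (for the permanent: `σ = Fin n × Fin n`) computed EXACTLY by an unbounded-fan-in circuit of
product-depth `≤ Δ` with `≤ s` wires (`DepthClass`), and `D̄(σ, Δ, s)` = its border: polynomials whose coefficient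
vector lies in the Zariski closure of the coefficient vectors of `D(σ, Δ, s)` (`BorderDepthClass`; the closure notion
of BLMW 2011 Def. 9.3.1 as rendered by the tree's `approxComplexity`: `zariskiClosure ∘ coeffVec`).  With
`D_n := D(Fin n × Fin n, Δ n, n^c + c)` and `D̄_n` its border:
`A_Δ  := ¬ ∃ c, ∀ n, per_n ∈ D_n`   (lens 4's attackable piece; `PerHardLog3` = `A_{Δ₁}`, Δ₁ = ⌊log₂⌊log₂⌊log₂ n⌋⌋⌋+1),
`B_Δ  := VP = VNP → ∃ c, ∀ n, per_n ∈ D_n`   (lens 4's declared residual; `CollapseLog3` = `B_{Δ₁}`),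
`Ā_Δ := ¬ ∃ c, ∀ n, per_n ∈ D̄_n`,  `B̄_Δ := VP = VNP → ∃ c, ∀ n, per_n ∈ D̄_n`  (`PerInDepthPoly`, `PerInBorderDepthPoly`).

WHAT IS PROVED (all kernel, elementary):
* §1 `D ⊆ D̄`, monotonicity; hence `B_Δ → B̄_Δ` (the border residual is WEAKER) and `Ā_Δ → A_Δ` (border hardness is
  STRONGER).
* §2 the border square decides the summit exactly like the exact one: `Ā_Δ → B̄_Δ → VH`, `B̄_Δ ↔ (Ā_Δ → VH)`
  (B̄ is exactly the residual of Ā), `VH → B̄_Δ` (necessity of B̄, vacuous).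
* §3 **TRANSFER = the certificate iff**: `Ā_Δ ↔ ∀ c, ∃ n, ∃ Q` (a polynomial in the coefficients) vanishing on
  `D_n = D(Fin n × Fin n, Δ n, n^c + c)` and not at `per_n` (`not_perInBorderDepthPoly_iff_certificates`).  So a lower-bound proof
  BY EQUATIONS — any measure `μ` with `{μ ≤ r}` cut out by polynomials in the coefficients, e.g. the rank of a matrix
  whose entries are polynomial in the coefficients (`rank_le_of_mem_borderDepthClass`: such ranks do not go up on
  `D̄`; partial-derivative / shifted-partials / relative-rank matrices are of this kind, with LINEAR entries) — proves
  `Ā_Δ`, not merely `A_Δ` (`not_perInBorderDepthPoly_of_rankCertificates`); and conversely `Ā_Δ` always HAS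
  polynomial certificates.  Consequence for a measure-attacked square `S ⟸ A ∧ B` (lens 4's `DepthWindow`, whose
  ladder `HomImmHardAt σ` is a relative-rank bound `relRank_aeval_eval_le` on every polynomial a small circuit
  computes): it may be replaced by `S ⟸ Ā ∧ B̄` at no cost on the attack side and with a WEAKER residual `B̄`.
* §5 `D̄` is closed under projections (variables ↦ variables/constants; BLMW §9.3 "closed under p-projections" for
  the dial): Zariski transport (`coeffVec_linearMap_mem_zariskiClosure`) on the bounded supports `deg ≤ 2^s`
  (`totalDegree_eval_le_two_pow_edgeSize`) — the step that moves border hardness from `IMM` to `per`.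
* §4 the dichotomy behind it: if `A_Δ` holds but `Ā_Δ` fails, then `per` is a BOUNDARY family of the depth class
  (in `D̄` at some polynomial budget, outside `D` at every polynomial budget) and NO equation certificate exists —
  equation/rank methods cannot prove `A_Δ` (`no_certificates_of_perInBorderDepthPoly`,
  `per_boundary_of_hard_of_borderEasy`).  This is the depth-dial instance of the boundary phenomenon `M` of the
  lens-3 square (`Theses/VPBoundarySquare.lean`, `BoundaryOfVPNonempty`).

Print status: folklore of geometric complexity theory — "continuous" lower-bound techniques (rank/flattening
equations) bound border complexity (Landsberg 2017 §8.2; Grochow 2015; BLMW 2011 §9.3), and the LST constant-depth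
bound indeed holds in the border setting (Andrews–Forbes 2022 Cor. 6.5, in tree over `F((ε))` as
`AndrewsForbes2022_cor_6_5_holds`; Dutta–Dwivedi–Saxena, *Demystifying the border of depth-3 circuits*, §1.3).
Kernel-new only as the typed dial and the certificate iff for the tree's Zariski rendering.

References: [BurgisserEtAl2011] §9.3; [LandsbergGCT2017] §8.2; [Grochow2015]; [AndrewsForbes2022] Cor. 6.5;
[LimayeSrinivasanTavenas2025] Cor. 4.
-/

-- layout Summits/ValiantsHypothesis/ValiantsHypothesis forces the duplicated namespace component
set_option linter.dupNamespace false

namespace Summit.ValiantsHypothesis.ValiantsHypothesis.Theorems.VPBoundarySquare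

open MvPolynomial Literature.Computability.AlgebraicComplexity ArithCircuit

noncomputable section

/-! ## §0 The dial, named -/

/-- `D(σ, Δ, s)`: polynomials in the variables `σ` computed EXACTLY by an unbounded-fan-in arithmetic circuit over `ℂ`
of product-depth `≤ Δ` with at most `s` wires (lens 4's written-out predicate; LST's size measure = wires).
[cite: LimayeSrinivasanTavenas2025, §1] -/
def DepthClass (σ : Type*) (Δ s : ℕ) : Set (MvPolynomial σ ℂ) :=
  {g | ∃ C : ArithCircuit ℂ σ, C.Computes g ∧ C.productDepth ≤ Δ ∧ C.edgeSize ≤ s}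

/-- `D̄(σ, Δ, s)`: the border of `D(σ, Δ, s)` — polynomials whose coefficient vector lies in the Zariski closure of
the coefficient vectors of `D(σ, Δ, s)` (BLMW 2011 Def. 9.3.1, the tree's rendering of approximate complexity).
[cite: BurgisserEtAl2011, Def. 9.3.1] -/
def BorderDepthClass (σ : Type*) (Δ s : ℕ) : Set (MvPolynomial σ ℂ) :=
  {g | coeffVec g ∈ zariskiClosure (coeffVec '' DepthClass σ Δ s)}

/-- `per ∈ D_Δ[poly]`: the permanent family has exact product-depth-`Δ` circuits with polynomially many wires.
[cite: LimayeSrinivasanTavenas2025, §1] -/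
def PerInDepthPoly (Δ : ℕ → ℕ) : Prop :=
  ∃ c : ℕ, ∀ n : ℕ, perPoly (Fin n) ℂ ∈ DepthClass (Fin n × Fin n) (Δ n) (n ^ c + c)

/-- `per ∈ D̄_Δ[poly]`: the permanent family lies in the BORDER of product-depth-`Δ` circuits with polynomially
many wires. [cite: BurgisserEtAl2011, Def. 9.3.1] -/
def PerInBorderDepthPoly (Δ : ℕ → ℕ) : Prop :=
  ∃ c : ℕ, ∀ n : ℕ, perPoly (Fin n) ℂ ∈ BorderDepthClass (Fin n × Fin n) (Δ n) (n ^ c + c)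

/-- `per ∈ D_Δ[poly]` is lens 4's written-out predicate on the nose (so `A_Δ = ¬ PerInDepthPoly Δ`,
`B_Δ = (VP = VNP → PerInDepthPoly Δ)`, and `PerHardLog3`, `CollapseLog3` of `Theses/DepthWindow.lean` are these at
`Δ₁ n = ⌊log₂⌊log₂⌊log₂ n⌋⌋⌋ + 1`). [folklore] -/
theorem perInDepthPoly_iff (Δ : ℕ → ℕ) :
    PerInDepthPoly Δ ↔ ∃ c : ℕ, ∀ n : ℕ, ∃ C : ArithCircuit ℂ (Fin n × Fin n),
      C.Computes (perPoly (Fin n) ℂ) ∧ C.productDepth ≤ Δ n ∧ C.edgeSize ≤ n ^ c + c :=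
  Iff.rfl

/-- Membership in the border class, written out. [cite: BurgisserEtAl2011, Def. 9.3.1] -/
theorem mem_borderDepthClass_iff {σ : Type*} {Δ s : ℕ} {f : MvPolynomial σ ℂ} :
    f ∈ BorderDepthClass σ Δ s ↔ coeffVec f ∈ zariskiClosure (coeffVec '' DepthClass σ Δ s) :=
  Iff.rfl

/-! ## §1 Exact ⊆ border; monotonicity; the residual weakens, the hardness strengthens -/

/-- `D(σ, Δ, s) ⊆ D̄(σ, Δ, s)`. [folklore] -/
theorem depthClass_subset_borderDepthClass (σ : Type*) (Δ s : ℕ) :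
    DepthClass σ Δ s ⊆ BorderDepthClass σ Δ s :=
  fun _ hg => subset_zariskiClosure _ (Set.mem_image_of_mem _ hg)

/-- `D` grows with depth and wires. [folklore] -/
theorem depthClass_mono {σ : Type*} {Δ Δ' s s' : ℕ} (hΔ : Δ ≤ Δ') (hs : s ≤ s') :
    DepthClass σ Δ s ⊆ DepthClass σ Δ' s' := by
  rintro g ⟨C, h1, h2, h3⟩
  exact ⟨C, h1, h2.trans hΔ, h3.trans hs⟩

/-- `D̄` grows with depth and wires. [folklore] -/
theorem borderDepthClass_mono {σ : Type*} {Δ Δ' s s' : ℕ} (hΔ : Δ ≤ Δ') (hs : s ≤ s') :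
    BorderDepthClass σ Δ s ⊆ BorderDepthClass σ Δ' s' :=
  fun _ hg => zariskiClosure_mono (Set.image_mono (depthClass_mono hΔ hs)) hg

/-- `per ∈ D_Δ[poly] → per ∈ D̄_Δ[poly]`. [folklore] -/
theorem perInBorderDepthPoly_of_perInDepthPoly {Δ : ℕ → ℕ} (h : PerInDepthPoly Δ) :
    PerInBorderDepthPoly Δ := by
  obtain ⟨c, hc⟩ := h
  exact ⟨c, fun n => depthClass_subset_borderDepthClass _ _ _ (hc n)⟩

/-- **The border residual is weaker**: `B_Δ → B̄_Δ`. [folklore] -/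
theorem collapseToBorderDepth_of_collapseToDepth {Δ : ℕ → ℕ}
    (hB : VP ℂ = VNP ℂ → PerInDepthPoly Δ) : VP ℂ = VNP ℂ → PerInBorderDepthPoly Δ :=
  fun hEq => perInBorderDepthPoly_of_perInDepthPoly (hB hEq)

/-- **Border hardness is stronger**: `Ā_Δ → A_Δ`. [folklore] -/
theorem perHardAtDepth_of_perBorderHardAtDepth {Δ : ℕ → ℕ} (hA : ¬ PerInBorderDepthPoly Δ) :
    ¬ PerInDepthPoly Δ :=
  fun h => hA (perInBorderDepthPoly_of_perInDepthPoly h)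

/-- Both dials are monotone in `Δ`: `per ∈ D̄_Δ[poly] → per ∈ D̄_{Δ'}[poly]` for `Δ ≤ Δ'`. [folklore] -/
theorem perInBorderDepthPoly_mono {Δ Δ' : ℕ → ℕ} (h : ∀ n, Δ n ≤ Δ' n) (hP : PerInBorderDepthPoly Δ) :
    PerInBorderDepthPoly Δ' := by
  obtain ⟨c, hc⟩ := hP
  exact ⟨c, fun n => borderDepthClass_mono (h n) le_rfl (hc n)⟩

/-! ## §2 The border square decides the summit; B̄ is exactly the residual of Ā -/

/-- **Assembly of the border square**: `Ā_Δ → B̄_Δ → VH`. [folklore] -/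
theorem vh_of_borderDial (Δ : ℕ → ℕ) (hA : ¬ PerInBorderDepthPoly Δ)
    (hB : VP ℂ = VNP ℂ → PerInBorderDepthPoly Δ) : _root_.ValiantsHypothesis := by
  intro hEq
  exact hA (hB hEq)

/-- Necessity of `B̄_Δ` (vacuous under VH). [folklore] -/
theorem collapseToBorderDepth_of_vh (Δ : ℕ → ℕ) (h : _root_.ValiantsHypothesis) :
    VP ℂ = VNP ℂ → PerInBorderDepthPoly Δ :=
  fun hEq => absurd hEq h

/-- **`B̄_Δ` is exactly the residual of `Ā_Δ`**: `B̄_Δ ↔ (Ā_Δ → VH)`. [folklore] -/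
theorem collapseToBorderDepth_iff_residual (Δ : ℕ → ℕ) :
    (VP ℂ = VNP ℂ → PerInBorderDepthPoly Δ) ↔ (¬ PerInBorderDepthPoly Δ → _root_.ValiantsHypothesis) := by
  constructor
  · intro hB hA hEq
    exact hA (hB hEq)
  · intro h hEq
    by_contra hno
    exact (h hno) hEq

/-- The exact square implies the border square's hypotheses piecewise where it can: from `(A_Δ → VH)` (= `B_Δ`)
one gets `(Ā_Δ → VH)` (= `B̄_Δ`). [folklore] -/
theorem borderResidual_of_residual (Δ : ℕ → ℕ) (h : ¬ PerInDepthPoly Δ → _root_.ValiantsHypothesis) :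
    ¬ PerInBorderDepthPoly Δ → _root_.ValiantsHypothesis :=
  fun hA => h (perHardAtDepth_of_perBorderHardAtDepth hA)

/-! ## §3 Transfer: border hardness ⟺ equation certificates; ranks do not go up on the border -/

/-- Membership in `D̄` = every polynomial equation (in the coefficients) of `D` holds. [cite: BurgisserEtAl2011, §9.3] -/
theorem mem_borderDepthClass_iff_equations {σ : Type*} {Δ s : ℕ} {f : MvPolynomial σ ℂ} :
    f ∈ BorderDepthClass σ Δ s ↔ ∀ Q : MvPolynomial (σ →₀ ℕ) ℂ,
      (∀ g ∈ DepthClass σ Δ s, aeval (coeffVec g) Q = 0) → aeval (coeffVec f) Q = 0 := by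
  rw [mem_borderDepthClass_iff, mem_zariskiClosure_iff]
  constructor
  · intro h Q hQ
    exact h Q (by rintro _ ⟨g, hg, rfl⟩; exact hQ g hg)
  · intro h Q hQ
    exact h Q fun g hg => hQ _ (Set.mem_image_of_mem _ hg)

/-- A single separating equation puts `f` outside the border class. [cite: BurgisserEtAl2011, §9.3] -/
theorem not_mem_borderDepthClass_of_equation {σ : Type*} {Δ s : ℕ} {f : MvPolynomial σ ℂ}
    (Q : MvPolynomial (σ →₀ ℕ) ℂ) (hQ : ∀ g ∈ DepthClass σ Δ s, aeval (coeffVec g) Q = 0)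
    (hf : aeval (coeffVec f) Q ≠ 0) : f ∉ BorderDepthClass σ Δ s :=
  fun h => hf (mem_borderDepthClass_iff_equations.1 h Q hQ)

/-- **TRANSFER (certificate iff).** `Ā_Δ` holds iff at every polynomial budget `n^c + c` some level `n` carries a
polynomial `Q` in the coefficients vanishing on `D_n = D(Fin n × Fin n, Δ n, n^c + c)` and not at `per_n`.  In words: border hardness
of the permanent at depth `Δ` is EXACTLY provability of hardness by equations; in particular every equation-based
proof of `A_Δ` proves `Ā_Δ`. [cite: BurgisserEtAl2011, §9.3] [cite: LandsbergGCT2017, §8.2] -/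
theorem not_perInBorderDepthPoly_iff_certificates (Δ : ℕ → ℕ) :
    ¬ PerInBorderDepthPoly Δ ↔
      ∀ c : ℕ, ∃ n : ℕ, ∃ Q : MvPolynomial ((Fin n × Fin n) →₀ ℕ) ℂ,
        (∀ g ∈ DepthClass (Fin n × Fin n) (Δ n) (n ^ c + c), aeval (coeffVec g) Q = 0) ∧
        aeval (coeffVec (perPoly (Fin n) ℂ)) Q ≠ 0 := by
  simp only [PerInBorderDepthPoly, not_exists, not_forall, mem_borderDepthClass_iff_equations, exists_prop, ne_eq]

/-- **Ranks of coefficient-polynomial matrices do not go up on the border.**  Let `M` be a matrix whose entries are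
polynomials in the coefficients (`M(g) := M.map (aeval (coeffVec g))`; partial-derivative, shifted-partials and
relative-rank matrices are of this kind, with linear entries).  If `rank M(g) ≤ r` on `D(σ, Δ, s)` then
`rank M(f) ≤ r` on `D̄(σ, Δ, s)`: an `(r+1)`-minor is an equation. [cite: LandsbergGCT2017, §8.2] [cite: Grochow2015, §1] -/
theorem rank_le_of_mem_borderDepthClass {σ : Type*} {Δ s : ℕ} {ι κ : Type*} [Fintype ι] [Fintype κ]
    [DecidableEq ι] [DecidableEq κ] (M : Matrix ι κ (MvPolynomial (σ →₀ ℕ) ℂ)) {r : ℕ}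
    (hS : ∀ g ∈ DepthClass σ Δ s, (M.map (aeval (coeffVec g))).rank ≤ r)
    {f : MvPolynomial σ ℂ} (hf : f ∈ BorderDepthClass σ Δ s) :
    (M.map (aeval (coeffVec f))).rank ≤ r := by
  classical
  have key : ∀ (p : MvPolynomial σ ℂ) (ρ : Fin (r + 1) → ι) (γ : Fin (r + 1) → κ),
      ((M.map (aeval (coeffVec p))).submatrix ρ γ).det = aeval (coeffVec p) (M.submatrix ρ γ).det := by
    intro p ρ γ
    rw [Matrix.submatrix_map, AlgHom.map_det, AlgHom.mapMatrix_apply]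
  rw [Literature.LinearAlgebra.Matrix.rank_le_iff_det_submatrix_eq_zero]
  intro ρ γ
  rw [key]
  refine (mem_borderDepthClass_iff_equations.1 hf) _ fun g hg => ?_
  rw [← key]
  exact (Literature.LinearAlgebra.Matrix.rank_le_iff_det_submatrix_eq_zero _).1 (hS g hg) ρ γ

/-- **A rank certificate proves BORDER hardness.**  If at every polynomial budget some level carries a
coefficient-polynomial matrix whose rank is `≤ r` on the exact class and `> r` at `per_n`, then `Ā_Δ`.
[cite: LandsbergGCT2017, §8.2] -/
theorem not_perInBorderDepthPoly_of_rankCertificates (Δ : ℕ → ℕ)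
    (h : ∀ c : ℕ, ∃ (n : ℕ) (m m' : ℕ) (M : Matrix (Fin m) (Fin m') (MvPolynomial ((Fin n × Fin n) →₀ ℕ) ℂ))
      (r : ℕ), (∀ g ∈ DepthClass (Fin n × Fin n) (Δ n) (n ^ c + c), (M.map (aeval (coeffVec g))).rank ≤ r) ∧
        r < (M.map (aeval (coeffVec (perPoly (Fin n) ℂ)))).rank) :
    ¬ PerInBorderDepthPoly Δ := by
  rintro ⟨c, hc⟩
  obtain ⟨n, m, m', M, r, hS, hper⟩ := h c
  exact absurd (rank_le_of_mem_borderDepthClass M hS (hc n)) (not_le.2 hper)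

/-! ## §4 The dichotomy: border-easy permanent = boundary family = no equation certificates -/

/-- If `per ∈ D̄_Δ[poly]` then no equation certificates exist: equation/rank methods cannot prove `A_Δ`.
[cite: BurgisserEtAl2011, §9.3] -/
theorem no_certificates_of_perInBorderDepthPoly {Δ : ℕ → ℕ} (h : PerInBorderDepthPoly Δ) :
    ¬ ∀ c : ℕ, ∃ n : ℕ, ∃ Q : MvPolynomial ((Fin n × Fin n) →₀ ℕ) ℂ,
        (∀ g ∈ DepthClass (Fin n × Fin n) (Δ n) (n ^ c + c), aeval (coeffVec g) Q = 0) ∧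
        aeval (coeffVec (perPoly (Fin n) ℂ)) Q ≠ 0 :=
  fun hc => (not_perInBorderDepthPoly_iff_certificates Δ).2 hc h

/-- **Boundary family.**  If `A_Δ` holds but `Ā_Δ` fails, the permanent is a boundary family of the depth class: at
some polynomial budget it lies in `D̄` at every level, while at every polynomial budget it lies outside `D` at some
level — the depth-dial instance of a non-empty boundary (`M` of `Theses/VPBoundarySquare.lean`). [folklore] -/
theorem per_boundary_of_hard_of_borderEasy {Δ : ℕ → ℕ} (hA : ¬ PerInDepthPoly Δ) (hcl : PerInBorderDepthPoly Δ) :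
    (∃ c : ℕ, ∀ n : ℕ, perPoly (Fin n) ℂ ∈ BorderDepthClass (Fin n × Fin n) (Δ n) (n ^ c + c)) ∧
      ∀ c : ℕ, ∃ n : ℕ, perPoly (Fin n) ℂ ∉ DepthClass (Fin n × Fin n) (Δ n) (n ^ c + c) := by
  refine ⟨hcl, fun c => ?_⟩
  by_contra h
  exact hA ⟨c, fun n => by_contra fun hn => h ⟨n, hn⟩⟩

/-- **Trichotomy of the dial at depth `Δ`, kernel**: exactly one of (i) `per ∈ D_Δ[poly]` (then `B_Δ`, and VH fails
iff …: lens 4's bracket theorems apply), (ii) `per` is a boundary family of the depth class (`A_Δ ∧ ¬Ā_Δ`: `A_Δ`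
true but unprovable by equations), (iii) `Ā_Δ` (certificates exist at every budget).  Stated as the disjunction;
the three cases are pairwise exclusive by `perInBorderDepthPoly_of_perInDepthPoly`. [folklore] -/
theorem dial_trichotomy (Δ : ℕ → ℕ) :
    PerInDepthPoly Δ ∨ (¬ PerInDepthPoly Δ ∧ PerInBorderDepthPoly Δ) ∨ ¬ PerInBorderDepthPoly Δ := by
  by_cases h1 : PerInDepthPoly Δ
  · exact Or.inl h1
  · by_cases h2 : PerInBorderDepthPoly Δ
    · exact Or.inr (Or.inl ⟨h1, h2⟩)
    · exact Or.inr (Or.inr h2)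


/-! ## §5 The border dial is closed under projections (variables ↦ variables / constants) -/

/-- The exact class is closed under projections: substituting variables or constants for the variables keeps the
wires and the product-depth (`ArithCircuit.substVC`). [cite: Burgisser2000, Rem. 2.2] -/
theorem aeval_substVCFun_mem_depthClass {σ τ : Type*} (φ : σ → τ ⊕ ℂ) {Δ s : ℕ} {g : MvPolynomial σ ℂ}
    (hg : g ∈ DepthClass σ Δ s) : aeval (substVCFun φ) g ∈ DepthClass τ Δ s := by
  obtain ⟨C, hC, hΔ, hs⟩ := hg
  refine ⟨C.substVC φ, ?_, by simpa using hΔ, by simpa using hs⟩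
  show (C.substVC φ).eval = _
  rw [eval_substVC]
  exact congrArg (aeval (substVCFun φ)) hC

/-- Polynomials of the exact class with `s` wires have total degree `≤ 2^s`, hence bounded supports (the
finite-dimensional pieces of BLMW 2011 §9.3). [cite: BurgisserEtAl2011, §9.3 (Def. 9.3.1)] -/
theorem support_subset_degBox_of_mem_depthClass {σ : Type*} [Fintype σ] [DecidableEq σ] {Δ s : ℕ}
    {g : MvPolynomial σ ℂ} (hg : g ∈ DepthClass σ Δ s) :
    g.support ⊆ (Finset.range (2 ^ s + 1)).biUnion (fun m => (Finset.univ : Finset σ).finsuppAntidiag m) := by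
  obtain ⟨C, hC, -, hs⟩ := hg
  refine support_subset_degBox_of_totalDegree_le ?_
  have h := C.totalDegree_eval_le_two_pow_edgeSize
  have hC' : C.eval = g := hC
  rw [hC'] at h
  exact h.trans (Nat.pow_le_pow_right (by norm_num) hs)

/-- **The border class is closed under projections** ("both classes are closed under p-projections", BLMW 2011
§9.3, for the product-depth dial): if `f ∈ D̄(σ, Δ, s)` then every substitution of variables / constants for the
variables of `f` lies in `D̄(τ, Δ, s)`.  Zariski-closure transport under the linear map `aeval (substVCFun φ)` on the
bounded supports of §5. [cite: BurgisserEtAl2011, §9.3] -/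
theorem aeval_substVCFun_mem_borderDepthClass {σ τ : Type*} [Fintype σ] [DecidableEq σ] (φ : σ → τ ⊕ ℂ)
    {Δ s : ℕ} {f : MvPolynomial σ ℂ} (hf : f ∈ BorderDepthClass σ Δ s) :
    aeval (substVCFun φ) f ∈ BorderDepthClass τ Δ s := by
  have h1 := coeffVec_linearMap_mem_zariskiClosure (aeval (substVCFun φ)).toLinearMap
    (fun g hg => support_subset_degBox_of_mem_depthClass (Δ := Δ) (s := s) hg) hf
  refine zariskiClosure_mono (Set.image_mono ?_) h1
  rintro _ ⟨g, hg, rfl⟩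
  exact aeval_substVCFun_mem_depthClass φ hg

/-- Contrapositive, the form used for transporting hardness along a projection (e.g. `IMM ≤_proj per`): if some
projection of `f` is outside `D̄(τ, Δ, s)` then `f ∉ D̄(σ, Δ, s)`. [cite: BurgisserEtAl2011, §9.3] -/
theorem not_mem_borderDepthClass_of_proj {σ τ : Type*} [Fintype σ] [DecidableEq σ] (φ : σ → τ ⊕ ℂ)
    {Δ s : ℕ} {f : MvPolynomial σ ℂ} (h : aeval (substVCFun φ) f ∉ BorderDepthClass τ Δ s) :
    f ∉ BorderDepthClass σ Δ s :=
  fun hf => h (aeval_substVCFun_mem_borderDepthClass φ hf)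

end

end Summit.ValiantsHypothesis.ValiantsHypothesis.Theorems.VPBoundarySquare
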